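import Summits.ABC.IUTFork.Thm311RealInd1StripGlobalStrictnessDyadicWitnessIndTwoSwap
import HarnessLib

/-!
# Row «C:PSI5-G1-INDTWO-ALL-COLLECTIONS» (R39c): the binder class of R36 (ψ5) at `H ≡ indTwo` is EMPTY at EVERY dyadic collection, for EVERY input
# in (ψ5)'s own class — a LATTICE TRANSVECTION in OUR typed full (Ind2) `indTwo` maps a pure tensor to a non-pure tensor, so it is not factorwise

Proof-only file of the abc-iut cell (sequel of the guard-decision row R39 ★ p624633 `…DyadicWitnessIndTwoSwap`, whose bytes — like R36 (ψ5) ★ p606976,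
R38 ★ p617014, R38b ★ p617696 — are untouched; live seat abc-iut-f-193 GEN 36; executed under GO-by-ruling C-R228 on this seat's OFFER R39c).  Statements about OUR typed packets, OUR
`indTwo` and OUR hypothesis shape `hHfac` only; empty-binder ≠ refuted; calibrated ≠ discharged; typed ≠ proved; it neither says print's (Ind2) is wrong
nor that (ψ5) is wrong; TAKES NO SIDE on [IUTchIII] Cor. 3.12 / Thm. 3.11 (Ind2) / [IUTchIV] Thm. 1.10, on reading (U) vs (P), or on any author; NO abc claim.

WHAT R39 LEFT.  R39 decided desk guard G1 at CONSTANT dyadic collections `e₁ ≡ w` (the factor swap needs equal factors); non-constant collections over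
fields with several places over `2` stayed «ISOLATED, not treated» (C-R225 (b)).  Here the constancy restriction is REMOVED with a different member of
`indTwo p k = Aut_{ℚ_p}(⊗_b K_b ; log_p(R_I^×))` that needs no equal factors: a lattice TRANSVECTION `T(x) = x + φ(x)·v`.

HOW (§1, packet level, ARBITRARY dependent family `k : Fin (n+2) → Type` of ultrametric proper normed `ℚ_p`-fields).  `v := ⊗_b α_b` with
`α_b = p^{M_b}·u_b` a small multiple (`‖α_b‖ ≤ p^{−a_b}`) of a basis vector `u_b`, so that `c·v = (⊗α)·c ∈ log_p(R_I^×)` for every `‖c‖ ≤ 1`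
(abc-iut-S6's `purePacket_mul_mem_logPacket` + `algebraMap_mem_integerPacket`; `smul_purePacket_mem_logPacket`); `φ := p^N·Λ_f` where
`Λ_f(⊗z) = ∏_b f_b(z_b)` for coordinate functionals `f_b` — EVERY such `Λ_f` is bounded on `log_p(R_I^×)` (`exists_pow_smul_lift_bounded`: each
`w ∈ log_p(R_I^×)` is `(⊗h)·y`, `y ∈ R_I`, by `exists_mem_integerPacket_of_mem_logPacket`; `integerPacket_induction`; finite-dimensional operator norms
(`ProperSpace ⇒ FiniteDimensional`, Riesz); ultrametric sums), so `‖φ‖ ≤ 1` there for `N ≫ 0`, and `φ(v) = 0` (the functional in slot `0` kills `u_0`).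
Then `T` and `T⁻¹ = x ∓ φ(x)·v` map `log_p(R_I^×)` into itself, i.e. `T ∈ indTwo` (`mem_indTwo_iff` BY NAME), while `T(⊗z) = ⊗z + p^N·⊗α` for the pure
tensor `z = (t₀, t₁, u₂, …)` (`t_b` a second basis vector in slots `0, 1` — this is where `[K_b : ℚ_p] ≥ 2` at TWO slots enters) is NOT a pure tensor:
the `2 × 2` minor `Λ_{λλ}·Λ_{μμ} − Λ_{λμ}·Λ_{μλ}` of coordinate functionals vanishes on every pure tensor and equals `p^N·∏_b p^{M_b} ≠ 0` here
(`exists_mem_indTwo_tprod_ne_tprod`).  A fortiori `T(⊗z) = ⊗_b F_b(z_b)` fails for ANY functions `F_b` (`exists_mem_indTwo_not_factorwise_of_two_le_finrank`).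
At a slot of local degree `1` nothing of the kind is claimed (two slots of degree `≥ 2` are the hypothesis).

CONSEQUENCE (§2, input level).  For every genuine Θ-volume input `I : ThetaVolumeInput F₀ K`, every procession index `i₁` and EVERY dyadic collection
`e₁ : Fin (i₁+2) → V(F₀)_2` — constant or not, places equal or distinct — whose section places at slots `0` and `1` have local degree `≥ 2`
(`not_hHfac_indTwo`), in particular for every input satisfying (ψ5)'s OWN dyadic hypothesis `hd` «every section place over `2` has local degree `2`»
(`not_hHfac_indTwo_of_dyadicLocalDegTwo`): R36 (ψ5)'s hypothesis `hHfac`, COPIED VERBATIM with the single substitution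
`H 2 Nat.prime_two ((i₁ : ℕ) + 1) e₁ ↦ indTwo 2 (fun b ↦ (I.σ.localFields 2).k (e₁ b))` (the right-hand side of (ψ5)'s own `hH`), is FALSE.

READING (numbers about OUR typed objects; neutral).  The binder class of R36 (ψ5) at `H ≡ indTwo` is EMPTY AS TYPED for EVERY input in (ψ5)'s class at
EVERY `(i₁, e₁)`; the R39 census word loses its «constant collection» proviso and the residual-ledger line «ISOLATED, not treated: non-constant dyadic
collections over fields with ≥ 2 places over 2» has no remaining content for G1.  What OUR typed full (Ind2) violates is the FACTORWISE SHAPE of (ψ5)'s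
compatibility hypothesis, in its weakest form (images of pure tensors need not be pure) — a TYPED GAP of the strictness instrument, NOT treated here; a
re-typing of (ψ5) with a non-factorwise compatibility hypothesis would be a different statement.  DISCHARGES NOTHING, REFUTES NOTHING, NO RESHAPE:
(ψ5) / R38 / R38b / R39 stand byte-identical; RESHAPE-4, `stub_cor312PerImage`, `ThetaPartII` untouched.

[cite: DupuyHilado2025, §4.9 (Ind2), Def. 3.6.1, Def. 3.6.3] [cite: Mochizuki2012, IUTchIII Thm. 3.11 (i) (Ind1)(Ind2) p. 154; IUTchIV Prop. 1.2 (i) p. 10–11]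
[cite: NeukirchANT1999, Ch. II Prop. (6.8)] [claim: Mochizuki2012, status: disputed] for every IUT quotation.  PROOF-ONLY: no definition, no instance,
no notation, no attribute, no `Prop` fact; the transvection, `v`, `φ` and the functionals are Mathlib terms built inside the proofs.
-/

set_option autoImplicit false

noncomputable section

open Metric Set Function Module
open scoped Pointwise TensorProduct

namespace Literature.IUT.LogVolume

/-! ## §1 Packet level: a lattice transvection in (Ind2) `indTwo` sends a pure tensor to a non-pure tensor -/

namespace IndTwoTransvection

open Literature.NumberTheory.GaloisRepresentations.Ultrametric

section General

variable (p : ℕ) [Fact p.Prime]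
variable {I : Type} [Fintype I] [DecidableEq I]
variable (k : I → Type) [∀ i, NontriviallyNormedField (k i)] [∀ i, NormedAlgebra ℚ_[p] (k i)]
  [∀ i, IsUltrametricDist (k i)] [∀ i, ProperSpace (k i)]

omit [Fintype I] in
/-- **`ℤ_p`-multiples of a small pure tensor lie in `log_p(R_I^×)`**: if `‖α_i‖ ≤ p^{−a_i}` for every `i`, then `c·(⊗α) = (⊗α)·c ∈ log_p(R_I^×)` for
every scalar `‖c‖ ≤ 1` (abc-iut-S6's third inclusion `⊗p^{a_i}R_i ⊆ log_p(R_I^×)` applied to `c ∈ R_I`). [cite: Mochizuki2012, IUTchIV Prop. 1.2 (i) p. 10–11] -/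
theorem smul_purePacket_mem_logPacket [Nonempty I] {α : Π i, k i}
    (hα : ∀ i, ‖α i‖ ≤ (p : ℝ) ^ (-logRadiusA p (absRamificationIdx p (k i)))) {c : ℚ_[p]} (hc : ‖c‖ ≤ 1) :
    c • purePacket p k α ∈ logPacket p k := by
  rw [Algebra.smul_def, mul_comm]
  exact purePacket_mul_mem_logPacket p k hα (algebraMap_mem_integerPacket p k hc)

omit [DecidableEq I] in
/-- **Every product functional is bounded on `log_p(R_I^×)`.**  For linear functionals `f_i` on the factors, the functional `Λ_f := lift(∏_i f_i)`
(`Λ_f(⊗z) = ∏ f_i(z_i)`) satisfies `‖p^N·Λ_f(w)‖ ≤ 1` for all `w ∈ log_p(R_I^×)` and some `N`: every such `w` is `(⊗h)·y` with `y ∈ R_I` (abc-iut-S6's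
fourth inclusion), `R_I` is additively generated by pure tensors of integers, `|Λ_f((⊗h)(⊗x))| = ∏|f_i(h_i x_i)| ≤ ∏ ‖f_i‖·‖h_i‖` by the
finite-dimensional operator norms (`K_i` proper ⇒ finite-dimensional, Riesz), and `ℚ_p` is ultrametric. [cite: Mochizuki2012, IUTchIV Prop. 1.2 (i) p. 10–11] -/
theorem exists_pow_smul_lift_bounded [Nonempty I] (f : Π i, (k i →ₗ[ℚ_[p]] ℚ_[p])) :
    ∃ N : ℕ, ∀ w ∈ logPacket p k,
      ‖((p : ℚ_[p]) ^ N • PiTensorProduct.lift ((MultilinearMap.mkPiAlgebra ℚ_[p] I ℚ_[p]).compLinearMap f)) w‖ ≤ 1 := by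
  haveI : ∀ i, FiniteDimensional ℚ_[p] (k i) := fun i => FiniteDimensional.of_locallyCompactSpace ℚ_[p]
  obtain ⟨h, hh⟩ := exists_realizesNegB p k
  -- bound of `Λ_f` on `(⊗h)·R_I ⊇ logPacket`
  let B : ℝ := ∏ i, ‖LinearMap.toContinuousLinearMap (f i)‖ * ‖h i‖
  have hB0 : 0 ≤ B := Finset.prod_nonneg fun i _ => mul_nonneg (norm_nonneg _) (norm_nonneg _)
  have hbound : ∀ w ∈ logPacket p k,
      ‖PiTensorProduct.lift ((MultilinearMap.mkPiAlgebra ℚ_[p] I ℚ_[p]).compLinearMap f) w‖ ≤ B := by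
    intro w hw
    obtain ⟨y, hy, rfl⟩ := exists_mem_integerPacket_of_mem_logPacket p k hh hw
    refine integerPacket_induction p k
      (C := fun t => ‖PiTensorProduct.lift ((MultilinearMap.mkPiAlgebra ℚ_[p] I ℚ_[p]).compLinearMap f)
        (purePacket p k h * t)‖ ≤ B) ?_ ?_ ?_ ?_ hy
    · intro x hx
      rw [purePacket_mul, purePacket, PiTensorProduct.lift.tprod, MultilinearMap.compLinearMap_apply,
        MultilinearMap.mkPiAlgebra_apply, norm_prod]
      refine Finset.prod_le_prod (fun i _ => norm_nonneg _) fun i _ => ?_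
      rw [Pi.mul_apply]
      calc ‖f i (h i * x i)‖ = ‖LinearMap.toContinuousLinearMap (f i) (h i * x i)‖ := rfl
        _ ≤ ‖LinearMap.toContinuousLinearMap (f i)‖ * ‖h i * x i‖ := ContinuousLinearMap.le_opNorm _ _
        _ ≤ ‖LinearMap.toContinuousLinearMap (f i)‖ * ‖h i‖ := by
          rw [norm_mul]
          exact mul_le_mul_of_nonneg_left (mul_le_of_le_one_right (norm_nonneg _) (hx i)) (norm_nonneg _)
    · rw [mul_zero, map_zero, norm_zero]
      exact hB0
    · intro a b ha hb
      rw [mul_add, map_add]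
      exact (IsUltrametricDist.norm_add_le_max _ _).trans (max_le ha hb)
    · intro a ha
      rw [mul_neg, map_neg, norm_neg]
      exact ha
  -- scale by `p^N ≥ B`
  have hp1 : 1 < (p : ℝ) := by exact_mod_cast (Fact.out : p.Prime).one_lt
  obtain ⟨N, hN⟩ := pow_unbounded_of_one_lt B hp1
  refine ⟨N, fun w hw => ?_⟩
  rw [LinearMap.smul_apply, norm_smul, Padic.norm_p_pow, zpow_neg, zpow_natCast]
  have hpN : 0 < (p : ℝ) ^ N := pow_pos (by linarith) N
  rw [inv_mul_le_iff₀ hpN, mul_one]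
  exact (hbound w hw).trans hN.le

end General

section TwoSlots

variable (p : ℕ) [Fact p.Prime]
variable {n : ℕ} (k : Fin (n + 2) → Type) [∀ i, NontriviallyNormedField (k i)] [∀ i, NormedAlgebra ℚ_[p] (k i)]
  [∀ i, IsUltrametricDist (k i)] [∀ i, ProperSpace (k i)]

/-- **A member of (Ind2) sending a pure tensor to a NON-pure tensor.**  Over an arbitrary family `K_0, …, K_{n+1}` of ultrametric proper normed
`ℚ_p`-fields with `[K_0 : ℚ_p] ≥ 2` and `[K_1 : ℚ_p] ≥ 2`, there are `γ ∈ indTwo = Aut_{ℚ_p}(⊗_b K_b ; log_p(R_I^×))` and a pure tensor `⊗z` such that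
`γ(⊗z)` is no pure tensor `⊗y` at all.  (`γ` = the transvection `x ↦ x + φ(x)·v` of the module docstring; `γ ∈ indTwo` via `mem_indTwo_iff` BY NAME;
non-purity by the `2 × 2` minor of coordinate functionals.) [cite: DupuyHilado2025, §4.9] [cite: Mochizuki2012, IUTchIV Prop. 1.2 (i) p. 10–11] -/
theorem exists_mem_indTwo_tprod_ne_tprod (h0 : 2 ≤ Module.finrank ℚ_[p] (k 0)) (h1 : 2 ≤ Module.finrank ℚ_[p] (k 1)) :
    ∃ γ ∈ indTwo p k, ∃ z : Π b, k b, ∀ y : Π b, k b,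
      γ (PiTensorProduct.tprod ℚ_[p] z) ≠ PiTensorProduct.tprod ℚ_[p] y := by
  classical
  haveI hfin : ∀ b, FiniteDimensional ℚ_[p] (k b) := fun b => FiniteDimensional.of_locallyCompactSpace ℚ_[p]
  have hd : ∀ b, 0 < Module.finrank ℚ_[p] (k b) := fun b => Module.finrank_pos
  have hp1 : 1 < (p : ℝ) := by exact_mod_cast (Fact.out : p.Prime).one_lt
  have hp0 : 0 < (p : ℝ) := by linarith
  -- bases, the distinguished vectors `u_b = β_b(0)`, `t₀ = β₀(1)`, `t₁ = β₁(1)` and their coordinate functionals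
  let β : Π b, Basis (Fin (Module.finrank ℚ_[p] (k b))) ℚ_[p] (k b) := fun b => Module.finBasis ℚ_[p] (k b)
  let j0 : Π b, Fin (Module.finrank ℚ_[p] (k b)) := fun b => ⟨0, hd b⟩
  let i0 : Fin (Module.finrank ℚ_[p] (k 0)) := ⟨1, h0⟩
  let i1 : Fin (Module.finrank ℚ_[p] (k (Fin.succ 0))) := ⟨1, h1⟩
  have hi0 : j0 0 ≠ i0 := Fin.ne_of_val_ne (show (0 : ℕ) ≠ 1 by norm_num)
  have hi1 : j0 (Fin.succ 0) ≠ i1 := Fin.ne_of_val_ne (show (0 : ℕ) ≠ 1 by norm_num)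
  let u : Π b, k b := fun b => β b (j0 b)
  let t0 : k 0 := β 0 i0
  let t1 : k (Fin.succ 0) := β (Fin.succ 0) i1
  let lam0 : k 0 →ₗ[ℚ_[p]] ℚ_[p] := (β 0).coord i0
  let mu0 : k 0 →ₗ[ℚ_[p]] ℚ_[p] := (β 0).coord (j0 0)
  let lam1 : k (Fin.succ 0) →ₗ[ℚ_[p]] ℚ_[p] := (β (Fin.succ 0)).coord i1
  let mu1 : k (Fin.succ 0) →ₗ[ℚ_[p]] ℚ_[p] := (β (Fin.succ 0)).coord (j0 (Fin.succ 0))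
  let rho : Π b : Fin n, (k b.succ.succ →ₗ[ℚ_[p]] ℚ_[p]) := fun b => (β b.succ.succ).coord (j0 b.succ.succ)
  have hlam0t : lam0 t0 = 1 := by rw [Basis.coord_apply, Basis.repr_self, Finsupp.single_apply, if_pos rfl]
  have hlam0u : lam0 (u 0) = 0 := by rw [Basis.coord_apply, Basis.repr_self, Finsupp.single_apply, if_neg hi0]
  have hmu0t : mu0 t0 = 0 := by rw [Basis.coord_apply, Basis.repr_self, Finsupp.single_apply, if_neg hi0.symm]
  have hmu0u : mu0 (u 0) = 1 := by rw [Basis.coord_apply, Basis.repr_self, Finsupp.single_apply, if_pos rfl]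
  have hlam1t : lam1 t1 = 1 := by rw [Basis.coord_apply, Basis.repr_self, Finsupp.single_apply, if_pos rfl]
  have hlam1u : lam1 (u (Fin.succ 0)) = 0 := by rw [Basis.coord_apply, Basis.repr_self, Finsupp.single_apply, if_neg hi1]
  have hmu1t : mu1 t1 = 0 := by rw [Basis.coord_apply, Basis.repr_self, Finsupp.single_apply, if_neg hi1.symm]
  have hmu1u : mu1 (u (Fin.succ 0)) = 1 := by rw [Basis.coord_apply, Basis.repr_self, Finsupp.single_apply, if_pos rfl]
  have hrho : ∀ b : Fin n, rho b (u b.succ.succ) = 1 := fun b => by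
    rw [Basis.coord_apply, Basis.repr_self, Finsupp.single_apply, if_pos rfl]
  -- the small pure tensor `v = ⊗ α_b`, `α_b = p^{M_b} u_b`, `‖α_b‖ ≤ p^{−a_b}`
  have hsmall : ∀ b, ∃ M : ℕ, ‖((p : ℚ_[p]) ^ M) • u b‖ ≤ (p : ℝ) ^ (-logRadiusA p (absRamificationIdx p (k b))) := by
    intro b
    have hu : 0 < ‖u b‖ := norm_pos_iff.mpr ((β b).ne_zero _)
    obtain ⟨M, hM⟩ := exists_pow_lt_of_lt_one
      (div_pos (Real.rpow_pos_of_pos hp0 _) hu) (inv_lt_one_of_one_lt₀ hp1)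
    refine ⟨M, ?_⟩
    rw [norm_smul, Padic.norm_p_pow, zpow_neg, zpow_natCast, ← inv_pow]
    exact (le_div_iff₀ hu).mp hM.le
  choose M hM using hsmall
  let α : Π b, k b := fun b => ((p : ℚ_[p]) ^ M b) • u b
  let v : PacketAlgebra p k := purePacket p k α
  have hv : ∀ c : ℚ_[p], ‖c‖ ≤ 1 → c • v ∈ logPacket p k := fun c hc => smul_purePacket_mem_logPacket p k hM hc
  have hlam0α : lam0 (α 0) = 0 := by simp only [α, map_smul, hlam0u, smul_zero]
  have hmu0α : mu0 (α 0) = (p : ℚ_[p]) ^ M 0 := by simp only [α, map_smul, hmu0u, smul_eq_mul, mul_one]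
  have hlam1α : lam1 (α (Fin.succ 0)) = 0 := by simp only [α, map_smul, hlam1u, smul_zero]
  have hmu1α : mu1 (α (Fin.succ 0)) = (p : ℚ_[p]) ^ M (Fin.succ 0) := by simp only [α, map_smul, hmu1u, smul_eq_mul, mul_one]
  have hrhoα : ∀ b : Fin n, rho b (α b.succ.succ) = (p : ℚ_[p]) ^ M b.succ.succ := fun b => by
    simp only [α, map_smul, hrho, smul_eq_mul, mul_one]
  -- the functionals `Λ_{g₀,g₁}(⊗ w) = g₀(w₀) · g₁(w₁) · ∏_{b ≥ 2} ρ_b(w_b)`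
  let fam : (k 0 →ₗ[ℚ_[p]] ℚ_[p]) → (k (Fin.succ 0) →ₗ[ℚ_[p]] ℚ_[p]) → Π b, (k b →ₗ[ℚ_[p]] ℚ_[p]) := fun g0 g1 =>
    Fin.cons (α := fun b : Fin (n + 2) => (k b →ₗ[ℚ_[p]] ℚ_[p])) g0
      (Fin.cons (α := fun b : Fin (n + 1) => (k b.succ →ₗ[ℚ_[p]] ℚ_[p])) g1 rho)
  let Λ : (k 0 →ₗ[ℚ_[p]] ℚ_[p]) → (k (Fin.succ 0) →ₗ[ℚ_[p]] ℚ_[p]) → (PacketAlgebra p k →ₗ[ℚ_[p]] ℚ_[p]) := fun g0 g1 =>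
    PiTensorProduct.lift ((MultilinearMap.mkPiAlgebra ℚ_[p] (Fin (n + 2)) ℚ_[p]).compLinearMap (fam g0 g1))
  have hΛ : ∀ g0 g1 (w : Π b, k b), Λ g0 g1 (PiTensorProduct.tprod ℚ_[p] w) =
      g0 (w 0) * (g1 (w (Fin.succ 0)) * ∏ b : Fin n, rho b (w b.succ.succ)) := by
    intro g0 g1 w
    simp only [Λ, PiTensorProduct.lift.tprod, MultilinearMap.compLinearMap_apply, MultilinearMap.mkPiAlgebra_apply,
      Fin.prod_univ_succ, fam, Fin.cons_zero, Fin.cons_succ]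
  -- the test pure tensor `⊗ z`, `z = (t₀, t₁, u₂, …)`
  let z : Π b, k b := Fin.cons (α := k) t0 (Fin.cons (α := fun b : Fin (n + 1) => k b.succ) t1 (fun b => u b.succ.succ))
  have hz0 : z 0 = t0 := rfl
  have hz1 : z (Fin.succ 0) = t1 := rfl
  have hzs : ∀ b : Fin n, z b.succ.succ = u b.succ.succ := fun b => rfl
  -- `φ = p^N · Λ_{λ₀,λ₁}` bounded by `1` on `logPacket`, with `φ(v) = 0` and `φ(⊗z) = p^N`
  obtain ⟨N, hN⟩ := exists_pow_smul_lift_bounded p k (fam lam0 lam1)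
  let φ : PacketAlgebra p k →ₗ[ℚ_[p]] ℚ_[p] := (p : ℚ_[p]) ^ N • Λ lam0 lam1
  have hφ1 : ∀ x ∈ logPacket p k, ‖φ x‖ ≤ 1 := hN
  have hφv : φ v = 0 := by
    show (p : ℚ_[p]) ^ N • Λ lam0 lam1 (PiTensorProduct.tprod ℚ_[p] α) = 0
    rw [hΛ, hlam0α, zero_mul, smul_zero]
  have hφz : φ (PiTensorProduct.tprod ℚ_[p] z) = (p : ℚ_[p]) ^ N := by
    show (p : ℚ_[p]) ^ N • Λ lam0 lam1 (PiTensorProduct.tprod ℚ_[p] z) = _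
    rw [hΛ, hz0, hz1, hlam0t, hlam1t]
    simp only [hzs, hrho, Finset.prod_const_one, mul_one, smul_eq_mul]
  -- the transvection `T(x) = x + φ(x)·v`, inverse `x − φ(x)·v`
  have hTinv₁ : (LinearMap.id + φ.smulRight v).comp (LinearMap.id - φ.smulRight v) = LinearMap.id := by
    ext x
    simp [LinearMap.smulRight_apply, map_sub, map_smul, hφv]
  have hTinv₂ : (LinearMap.id - φ.smulRight v).comp (LinearMap.id + φ.smulRight v) = LinearMap.id := by
    ext x
    simp [LinearMap.smulRight_apply, map_add, map_smul, hφv]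
  let T : PacketAlgebra p k ≃ₗ[ℚ_[p]] PacketAlgebra p k :=
    LinearEquiv.ofLinear (LinearMap.id + φ.smulRight v) (LinearMap.id - φ.smulRight v) hTinv₁ hTinv₂
  have hT : ∀ x, T x = x + φ x • v := fun x => rfl
  have hTsymm : ∀ x, T.symm x = x - φ x • v := fun x => rfl
  refine ⟨T, ?_, z, fun y hy => ?_⟩
  · -- `T ∈ indTwo`: `T` and `T⁻¹` map `logPacket` into itself
    rw [mem_indTwo_iff]
    intro x
    constructor
    · intro hx
      have hx' : T.symm (T x) ∈ logPacket p k := by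
        rw [hTsymm]
        exact sub_mem hx (hv _ (hφ1 _ hx))
      rwa [LinearEquiv.symm_apply_apply] at hx'
    · intro hx
      rw [hT]
      exact add_mem hx (hv _ (hφ1 _ hx))
  · -- `T(⊗z) = ⊗z + p^N·⊗α` is not a pure tensor: the `2 × 2` minor of `(Λ_{λλ}, Λ_{μμ}; Λ_{λμ}, Λ_{μλ})` is `≠ 0`
    rw [hT, hφz] at hy
    -- values on `⊗ y`: the minor vanishes
    have hyA := congrArg (Λ lam0 lam1) hy
    have hyB := congrArg (Λ mu0 mu1) hy
    have hyC := congrArg (Λ lam0 mu1) hy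
    have hyD := congrArg (Λ mu0 lam1) hy
    simp only [map_add, map_smul, v, purePacket, hΛ, hz0, hz1, hzs, hlam0t, hlam1t, hmu0t, hmu1t, hrho, hlam0α, hlam1α,
      hmu0α, hmu1α, hrhoα, Finset.prod_const_one, mul_one, mul_zero, zero_mul, smul_eq_mul, add_zero, zero_add] at hyA hyB hyC hyD
    -- `hyA : 1 = λ₀(y₀)·(λ₁(y₁)·R)`, `hyB : p^N·(p^{M₀}·(p^{M₁}·∏ p^{M_b})) = μ₀(y₀)·(μ₁(y₁)·R)`, `hyC : 0 = λ₀(y₀)·(μ₁(y₁)·R)`,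
    -- `hyD : 0 = μ₀(y₀)·(λ₁(y₁)·R)`
    have hminor : lam0 (y 0) * (lam1 (y (Fin.succ 0)) * ∏ b : Fin n, rho b (y b.succ.succ)) *
        (mu0 (y 0) * (mu1 (y (Fin.succ 0)) * ∏ b : Fin n, rho b (y b.succ.succ))) =
        lam0 (y 0) * (mu1 (y (Fin.succ 0)) * ∏ b : Fin n, rho b (y b.succ.succ)) *
        (mu0 (y 0) * (lam1 (y (Fin.succ 0)) * ∏ b : Fin n, rho b (y b.succ.succ))) := by ring
    rw [← hyA, ← hyB, ← hyC, ← hyD, one_mul, zero_mul] at hminor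
    have hpne : ∀ m : ℕ, ((p : ℚ_[p]) ^ m) ≠ 0 := fun m => pow_ne_zero _ (by exact_mod_cast (Fact.out : p.Prime).ne_zero)
    refine absurd hminor (mul_ne_zero (hpne N) (mul_ne_zero (hpne _) (mul_ne_zero (hpne _) ?_)))
    exact Finset.prod_ne_zero_iff.mpr fun b _ => hpne _


/-- **(Ind2) `indTwo` is not factorwise as soon as TWO slots have local degree `≥ 2`** (any dependent family; no equal factors needed): it has a member
`γ` such that for NO functions `F_b : K_b → K_b` is `γ(⊗_b z_b) = ⊗_b F_b(z_b)` for all `z` (images of pure tensors under such a `γ` would be pure).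
[cite: DupuyHilado2025, §4.9] [cite: Mochizuki2012, IUTchIV Prop. 1.2 (i) p. 10–11] -/
theorem exists_mem_indTwo_not_factorwise_of_two_le_finrank (h0 : 2 ≤ Module.finrank ℚ_[p] (k 0))
    (h1 : 2 ≤ Module.finrank ℚ_[p] (k 1)) :
    ∃ γ ∈ indTwo p k, ∀ F : Π b, k b → k b,
      ¬ ∀ z : Π b, k b, γ (PiTensorProduct.tprod ℚ_[p] z) = PiTensorProduct.tprod ℚ_[p] (fun b => F b (z b)) := by
  obtain ⟨γ, hγ, z, hz⟩ := exists_mem_indTwo_tprod_ne_tprod p k h0 h1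
  exact ⟨γ, hγ, fun F hF => hz _ (hF z)⟩

end TwoSlots

end IndTwoTransvection

/-! ## §2 Input level: (ψ5)'s `hHfac` is unsatisfiable at `H ≡ indTwo` at EVERY dyadic collection -/

namespace ThetaVolumeInput

open Summit.ABC.IUTFork.Thm311.Real Literature.NumberTheory.NumberFields Function
open Literature.NumberTheory.GaloisRepresentations Literature.NumberTheory.GaloisRepresentations.Ultrametric
open Literature.AnabelianGeometry.AbsoluteAnabelian Literature.IUT.HodgeArakelov
open Literature.IUT.HodgeArakelov.AbsTopMonoids NumberField IsDedekindDomain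

variable {F₀ : Type} [Field F₀] [NumberField F₀] {K : Type} [Field K] [NumberField K] [Algebra F₀ K]
variable (I : ThetaVolumeInput F₀ K)

namespace IndTwoTransvection

/-- **(ψ5)'s `hHfac` FAILS at `H ≡ indTwo` at EVERY dyadic collection (no constancy, no equal places).**  For every genuine Θ-volume input
`I : ThetaVolumeInput F₀ K`, every procession index `i₁` and every collection `e₁ : Fin (i₁+2) → V(F₀)_2` whose section places in slots `0` and `1`
have local degree `[K_{e̲₁b} : ℚ₂] ≥ 2` (HYPOTHESES `h0`, `h1`; with a slot of local degree `1` among the first two nothing is claimed): the NEGATION of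
R36 (ψ5)'s hypothesis `hHfac` — COPIED VERBATIM from `sum_lnνLp_hull_orbitH_ne_negLogThetaPerImageNonarch_of_dyadicSqrtNegOne` (same `δ`-type, same
`AddSubgroup.closure` of `ind1StripOf`, same `RescaledCompletion.of` conjugation, same `PiTensorProduct.tprod` shape) with the single substitution
`H 2 Nat.prime_two ((i₁ : ℕ) + 1) e₁ ↦ indTwo 2 (fun b ↦ (I.σ.localFields 2).k (e₁ b))`.  Indeed some `γ ∈ indTwo` there (a lattice transvection, §1)
maps a pure tensor to a non-pure tensor, so it admits no `δ` at all.  A statement about OUR typed `hHfac` shape and OUR `indTwo` only.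
[claim: Mochizuki2012, status: disputed] [cite: Mochizuki2012, IUTchIII Thm. 3.11 (i) (Ind1)(Ind2) p. 154] [cite: DupuyHilado2025, §4.7, §4.9] -/
theorem not_hHfac_indTwo (i₁ : Fin I.lstar) (e₁ : Fin ((i₁ : ℕ) + 1 + 1) → placesOver F₀ 2)
    (h0 : 2 ≤ localDeg K (I.σ.lift (e₁ 0).1)) (h1 : 2 ≤ localDeg K (I.σ.lift (e₁ 1).1)) :
    ¬ ∀ γ ∈ indTwo 2 (fun b => (I.σ.localFields 2).k (e₁ b)), ∃ δ : Π b, AddAut ((I.σ.lift (e₁ b).1).adicCompletion K),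
      (∀ b, δ b ∈ AddSubgroup.closure (G := AddAut ((I.σ.lift (e₁ b).1).adicCompletion K))
        (ind1StripOf (I.σ.lift (e₁ b).1) (galoisLog (I.σ.lift (e₁ b).1)))) ∧
      ∀ z : Π b, (I.σ.localFields 2).k (e₁ b),
        (γ : PacketAlgebra 2 (fun b => (I.σ.localFields 2).k (e₁ b)) ≃ₗ[ℚ_[2]]
            PacketAlgebra 2 (fun b => (I.σ.localFields 2).k (e₁ b))) (PiTensorProduct.tprod ℚ_[2] z) =
          PiTensorProduct.tprod ℚ_[2] (fun b => RescaledCompletion.of K 2 (I.σ.lift (e₁ b).1) (I.σ.natCast_mem_lift (e₁ b))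
            (δ b ((RescaledCompletion.of K 2 (I.σ.lift (e₁ b).1) (I.σ.natCast_mem_lift (e₁ b))).symm (z b)))) := by
  intro h
  obtain ⟨γ, hγ, hγF⟩ :=
    Literature.IUT.LogVolume.IndTwoTransvection.exists_mem_indTwo_not_factorwise_of_two_le_finrank 2
      (fun b => (I.σ.localFields 2).k (e₁ b)) (by rw [PlaceSection.finrank_localFields_k]; exact h0)
      (by rw [PlaceSection.finrank_localFields_k]; exact h1)
  obtain ⟨δ, -, hδ⟩ := h γ hγ
  exact hγF (fun b x => RescaledCompletion.of K 2 (I.σ.lift (e₁ b).1) (I.σ.natCast_mem_lift (e₁ b))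
    (δ b ((RescaledCompletion.of K 2 (I.σ.lift (e₁ b).1) (I.σ.natCast_mem_lift (e₁ b))).symm x))) hδ

/-- **… in particular for EVERY input in (ψ5)'s own class, at EVERY `(i₁, e₁)`.**  Under (ψ5)'s dyadic hypothesis `hd` «every section place over `2`
has local degree `2`» (its other hypotheses `s² = −1`, `hH` are not even needed), the `hHfac` clause with `H ≡ indTwo` is false at every procession
index and every dyadic collection: the binder class of R36 (ψ5) at `H ≡ indTwo` is EMPTY AS TYPED — (ψ5) is calibrated on factorwise sub-families of
(Ind2) only.  Empty-binder ≠ refuted; discharges nothing; no side taken. [claim: Mochizuki2012, status: disputed]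
[cite: Mochizuki2012, IUTchIII Thm. 3.11 (i) (Ind1)(Ind2) p. 154; Cor. 3.12 p. 174] [cite: DupuyHilado2025, Def. 3.6.3, §4.7, §4.9] -/
theorem not_hHfac_indTwo_of_dyadicLocalDegTwo (hd : ∀ w : placesOver F₀ 2, localDeg K (I.σ.lift w.1) = 2) (i₁ : Fin I.lstar)
    (e₁ : Fin ((i₁ : ℕ) + 1 + 1) → placesOver F₀ 2) :
    ¬ ∀ γ ∈ indTwo 2 (fun b => (I.σ.localFields 2).k (e₁ b)), ∃ δ : Π b, AddAut ((I.σ.lift (e₁ b).1).adicCompletion K),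
      (∀ b, δ b ∈ AddSubgroup.closure (G := AddAut ((I.σ.lift (e₁ b).1).adicCompletion K))
        (ind1StripOf (I.σ.lift (e₁ b).1) (galoisLog (I.σ.lift (e₁ b).1)))) ∧
      ∀ z : Π b, (I.σ.localFields 2).k (e₁ b),
        (γ : PacketAlgebra 2 (fun b => (I.σ.localFields 2).k (e₁ b)) ≃ₗ[ℚ_[2]]
            PacketAlgebra 2 (fun b => (I.σ.localFields 2).k (e₁ b))) (PiTensorProduct.tprod ℚ_[2] z) =
          PiTensorProduct.tprod ℚ_[2] (fun b => RescaledCompletion.of K 2 (I.σ.lift (e₁ b).1) (I.σ.natCast_mem_lift (e₁ b))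
            (δ b ((RescaledCompletion.of K 2 (I.σ.lift (e₁ b).1) (I.σ.natCast_mem_lift (e₁ b))).symm (z b)))) :=
  not_hHfac_indTwo I i₁ e₁ (hd (e₁ 0)).ge (hd (e₁ 1)).ge

end IndTwoTransvection

end ThetaVolumeInput

end Literature.IUT.LogVolume

end
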